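import Summits.CriticalPhenomena.PercolationContinuityZ3.Theorems.SahiMasterFamilyFCombFReadOnce
import Summits.CriticalPhenomena.PercolationContinuityZ3.Theorems.SahiMasterFamilyFCombFThreshold
import Summits.CriticalPhenomena.PercolationContinuityZ3.Theorems.SahiMasterFamilyZeroFlagMinorF
import Summits.CriticalPhenomena.PercolationContinuityZ3.Theorems.PercNearOneGluingNoHeavyLowerTailSahiCoordinateTwoThirdsFiveCube
import Summits.CriticalPhenomena.PercolationContinuityZ3.Theorems.PercNearOneGluingNoHeavyLowerTailSahiC4CombBridge
import Mathlib.Tactic.Linarith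
import HarnessLib

/-!
# Bridge: the `SahiFComb` cube theorems (`F ≥ 0` for read-once / threshold third events) in the tree's `Set (Set ι)` /
# `ex (bernoulliWeight p) (ind ·)` vocabulary

Support file (cell `prim-bnk`, seat bnk-2 gen 21; `--supports stmt-CriticalPhenomena-4575`; memo
`run/shared/lean/prim/prim-l12/FROM-prim-bnk-2-g20-CP-CERTIFICATES.md` §7(0)).  No definition, no `sorry`, standard axioms.

Gen 20 proved, in the Boolean-function encoding (events `(Fin n → Bool) → Bool`, weights `∏ i (p i if s i else 1 − p i)`), the
master-family inequality of `prim-master-conj` (POINTWISE §21)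
  `F(A,B;G) := (1 + μG)·μ(A∩B∩G) − μG·μ(A∩B) − μ(A∩G)·μ(B∩G) ≥ 0`
for all monotone `A, B`, every product measure, whenever `G` is READ-ONCE (`SahiFComb.F_nonneg_readOnce`) or a THRESHOLD event
(`SahiFComb.F_nonneg_threshold`).  The consumers (`Pointwise.sahiE_three_ge_sq_minor_of_F_nonneg`, the D0 core of the `MD₃` programme, and
the `SahiFInduction` files) speak the tree's vocabulary: a finite index type `ι`, `p : ι → unitInterval`, increasing events
`A B G : Set (Set ι)`, and `μX = ex (bernoulliWeight p) (ind X)`.  This file is the translation: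

* `fIneq_nonneg_fin_of_cube` — on `ι = Fin n`: the tree's `F`-expression equals the cube expression for any Boolean functions
  REPRESENTING the three events on Boolean coordinates (`χ s = true ↔ cubeEquivSet n s ∈ X`; `ex_ind_eq_cube_sum`), so every cube theorem transfers;
* `fIneq_nonneg_of_equiv` — any finite `ι`: transport along `e : ι ≃ Fin n` (`ThreePartition.comapFam`, the P3 relabelling lemmas);
* **`fIneq_nonneg_of_threshold`** — `F(A,B;G) ≥ 0` for all increasing `A, B ⊆ Set (Set ι)`, every `p`, and `G = {ω | t ≤ ω.ncard}`
  (at least `t` open coordinates; majority included);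
* **`fIneq_nonneg_of_readOnce`** — the same for `G = {ω | φ.eval ((cubeEquivSet n).symm (e '' ω))}`, `φ` any read-once monotone formula
  (`SahiFComb.MForm`, each variable at most once) read through an enumeration `e : ι ≃ Fin n` (principal filters, ORs, caterpillars,
  `≤ 2` minimal elements, `(x₁x₂ ∨ x₃x₄)(x₅ ∨ x₆x₇)`, …);
* `sahiE_three_ge_sq_minor_of_third_readOnce` / `_of_third_threshold` — the D0-core consequences: `MD₃` at `(U,e)`,
  `(1−p_e)²E₃(U⁰) + p_e²E₃(U¹) ≤ E₃(U)`, is unconditional when the (`e`-free) third member `U_2^{e←0}` is such an event.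
HONEST FRAMING: translation only; `F ≥ 0` for a general increasing third event remains OPEN (memo: CONJECTURE CP). [this work]
-/

noncomputable section

open scoped Classical

namespace Summit.CriticalPhenomena.PercolationContinuityZ3.Theorems

namespace SahiFCombBridge

open Finset Function
open Literature.Combinatorics.Sahi2008
open Literature.Probability.Percolation.DecisionTree (ind ind_of_mem ind_of_not_mem ind_nonneg)
open SahiBlockExchangeable (cubeEquivSet mem_cubeEquivSet)
open SahiCoordinateTwoThirds (ex_bernoulliWeight_eq_sum_cube)
open ThreePartition (comapFam comapFam_inter)
open SahiC4CombBridge (isUpperSet_comapFam sahiE_bernoulliWeight_comap_equiv)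

/-! ### 1. The cube `Fin n`: expectations of indicators as Boolean-cube sums -/

section Cube

variable {n : ℕ}

/-- `μ_p(X) = Σ_s w_p(s)·[χ s]` for any Boolean function `χ` representing `X` on Boolean coordinates, with the `SahiFComb` weights
`∏ i (p i if s i else 1 − p i)`. [this work] -/
theorem ex_ind_eq_cube_sum (p : Fin n → unitInterval) (X : Set (Set (Fin n))) (χ : (Fin n → Bool) → Bool)
    (hχ : ∀ s, χ s = true ↔ cubeEquivSet n s ∈ X) :
    ex (bernoulliWeight p) (ind X)
      = ∑ s : Fin n → Bool, (∏ i, (if s i then (p i : ℝ) else 1 - (p i : ℝ))) * ((Bool.toNat (χ s) : ℕ) : ℝ) := by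
  rw [ex_bernoulliWeight_eq_sum_cube]
  refine Finset.sum_congr rfl fun s _ => ?_
  have hw : coinWeight (fun i => (p i : ℝ)) s = ∏ i, (if s i then (p i : ℝ) else 1 - (p i : ℝ)) := rfl
  rw [hw]
  congr 1
  by_cases h : cubeEquivSet n s ∈ X
  · rw [ind_of_mem h, (hχ s).2 h]; simp
  · have hf : χ s = false := by
      cases hc : χ s
      · rfl
      · exact absurd ((hχ s).1 hc) h
    rw [ind_of_not_mem h, hf]; simp

/-- Representing an intersection by the conjunction. [this work] -/
theorem rep_inter {X Y : Set (Set (Fin n))} {χ ψ : (Fin n → Bool) → Bool}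
    (hχ : ∀ s, χ s = true ↔ cubeEquivSet n s ∈ X) (hψ : ∀ s, ψ s = true ↔ cubeEquivSet n s ∈ Y) :
    ∀ s, (χ s && ψ s) = true ↔ cubeEquivSet n s ∈ X ∩ Y := fun s => by
  rw [Bool.and_eq_true, hχ s, hψ s, Set.mem_inter_iff]

/-- The canonical representative `s ↦ [cubeEquivSet n s ∈ X]`. [this work] -/
theorem rep_decide (X : Set (Set (Fin n))) : ∀ s : Fin n → Bool, decide (cubeEquivSet n s ∈ X) = true ↔ cubeEquivSet n s ∈ X :=
  fun _ => decide_eq_true_iff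

/-- An increasing event, read on Boolean coordinates, is a monotone Boolean function. [this work] -/
theorem monotone_of_rep {X : Set (Set (Fin n))} (hX : IsUpperSet X) {χ : (Fin n → Bool) → Bool}
    (hχ : ∀ s, χ s = true ↔ cubeEquivSet n s ∈ X) : Monotone χ := by
  intro s s' hle
  have hsub : cubeEquivSet n s ≤ cubeEquivSet n s' := by
    intro i hi
    rw [mem_cubeEquivSet] at hi ⊢
    exact Bool.le_iff_imp.1 (hle i) hi
  exact Bool.le_iff_imp.2 fun h => (hχ s').2 (hX hsub ((hχ s).1 h))

/-- **Transfer on the cube.**  On `ι = Fin n` the tree's `F(A,B;G)` equals the `SahiFComb` cube expression for any Boolean functions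
representing `A, B, G` on Boolean coordinates; hence any cube inequality gives the tree's. [this work] -/
theorem fIneq_nonneg_fin_of_cube (p : Fin n → unitInterval) (A B G : Set (Set (Fin n))) (χA χB χG : (Fin n → Bool) → Bool)
    (hA : ∀ s, χA s = true ↔ cubeEquivSet n s ∈ A) (hB : ∀ s, χB s = true ↔ cubeEquivSet n s ∈ B)
    (hG : ∀ s, χG s = true ↔ cubeEquivSet n s ∈ G)
    (h : 0 ≤ (1 + ∑ s : Fin n → Bool, (∏ i, (if s i then (p i : ℝ) else 1 - (p i : ℝ))) * (Bool.toNat (χG s) : ℝ))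
        * (∑ s : Fin n → Bool, (∏ i, (if s i then (p i : ℝ) else 1 - (p i : ℝ))) * (Bool.toNat (χA s && χB s && χG s) : ℝ))
      - (∑ s : Fin n → Bool, (∏ i, (if s i then (p i : ℝ) else 1 - (p i : ℝ))) * (Bool.toNat (χG s) : ℝ))
        * (∑ s : Fin n → Bool, (∏ i, (if s i then (p i : ℝ) else 1 - (p i : ℝ))) * (Bool.toNat (χA s && χB s) : ℝ))
      - (∑ s : Fin n → Bool, (∏ i, (if s i then (p i : ℝ) else 1 - (p i : ℝ))) * (Bool.toNat (χA s && χG s) : ℝ))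
        * (∑ s : Fin n → Bool, (∏ i, (if s i then (p i : ℝ) else 1 - (p i : ℝ))) * (Bool.toNat (χB s && χG s) : ℝ))) :
    0 ≤ (1 + ex (bernoulliWeight p) (ind G)) * ex (bernoulliWeight p) (ind (A ∩ B ∩ G))
        - ex (bernoulliWeight p) (ind G) * ex (bernoulliWeight p) (ind (A ∩ B))
        - ex (bernoulliWeight p) (ind (A ∩ G)) * ex (bernoulliWeight p) (ind (B ∩ G)) := by
  rw [ex_ind_eq_cube_sum p G χG hG, ex_ind_eq_cube_sum p (A ∩ B ∩ G) (fun s => χA s && χB s && χG s) (rep_inter (rep_inter hA hB) hG),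
    ex_ind_eq_cube_sum p (A ∩ B) (fun s => χA s && χB s) (rep_inter hA hB),
    ex_ind_eq_cube_sum p (A ∩ G) (fun s => χA s && χG s) (rep_inter hA hG),
    ex_ind_eq_cube_sum p (B ∩ G) (fun s => χB s && χG s) (rep_inter hB hG)]
  exact h

/-- The number of `true` coordinates is the cardinality of the corresponding subset of `Fin n`. [folklore] -/
theorem ncard_cubeEquivSet (s : Fin n → Bool) : (cubeEquivSet n s).ncard = ∑ i, Bool.toNat (s i) := by
  have h1 : cubeEquivSet n s = ↑(Finset.univ.filter (fun i => s i = true)) := by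
    ext i; simp [mem_cubeEquivSet]
  rw [h1, Set.ncard_coe_finset, Finset.card_filter]
  exact Finset.sum_congr rfl (fun i _ => by cases s i <;> simp)

/-- The threshold function represents the threshold event. [this work] -/
theorem rep_threshold (t : ℕ) :
    ∀ s : Fin n → Bool, decide (t ≤ ∑ i, Bool.toNat (s i)) = true ↔ cubeEquivSet n s ∈ {ω : Set (Fin n) | t ≤ ω.ncard} := fun s => by
  rw [decide_eq_true_iff, Set.mem_setOf_eq, ncard_cubeEquivSet]

/-- A formula represents the event it cuts out. [this work] -/
theorem rep_eval (φ : SahiFComb.MForm n) :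
    ∀ s : Fin n → Bool, φ.eval s = true ↔ cubeEquivSet n s ∈ {ω : Set (Fin n) | φ.eval ((cubeEquivSet n).symm ω) = true} := fun s => by
  rw [Set.mem_setOf_eq, Equiv.symm_apply_apply]

/-- **`F ≥ 0` for threshold third events, cube `Fin n`, tree vocabulary**: `G = {ω | t ≤ ω.ncard}`. [this work] -/
theorem fIneq_nonneg_fin_threshold (n t : ℕ) (p : Fin n → unitInterval) (A B : Set (Set (Fin n))) (hA : IsUpperSet A) (hB : IsUpperSet B) :
    0 ≤ (1 + ex (bernoulliWeight p) (ind {ω : Set (Fin n) | t ≤ ω.ncard}))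
          * ex (bernoulliWeight p) (ind (A ∩ B ∩ {ω : Set (Fin n) | t ≤ ω.ncard}))
        - ex (bernoulliWeight p) (ind {ω : Set (Fin n) | t ≤ ω.ncard}) * ex (bernoulliWeight p) (ind (A ∩ B))
        - ex (bernoulliWeight p) (ind (A ∩ {ω : Set (Fin n) | t ≤ ω.ncard}))
          * ex (bernoulliWeight p) (ind (B ∩ {ω : Set (Fin n) | t ≤ ω.ncard})) :=
  fIneq_nonneg_fin_of_cube p A B _ (fun s => decide (cubeEquivSet n s ∈ A)) (fun s => decide (cubeEquivSet n s ∈ B))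
    (fun s => decide (t ≤ ∑ i, Bool.toNat (s i))) (rep_decide A) (rep_decide B) (rep_threshold t)
    (SahiFComb.F_nonneg_of_eq_threshold n t (fun i => (p i : ℝ)) (fun i => (p i).2.1) (fun i => (p i).2.2)
      (fun s => decide (cubeEquivSet n s ∈ A)) (fun s => decide (cubeEquivSet n s ∈ B)) (fun s => decide (t ≤ ∑ i, Bool.toNat (s i)))
      (monotone_of_rep hA (rep_decide A)) (monotone_of_rep hB (rep_decide B)) rfl)

/-- **`F ≥ 0` for read-once third events, cube `Fin n`, tree vocabulary**: `G = {ω | φ.eval ((cubeEquivSet n).symm ω)}`,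
`φ` read-once. [this work] -/
theorem fIneq_nonneg_fin_readOnce (φ : SahiFComb.MForm n) (hφ : φ.ReadOnce) (p : Fin n → unitInterval) (A B : Set (Set (Fin n)))
    (hA : IsUpperSet A) (hB : IsUpperSet B) :
    0 ≤ (1 + ex (bernoulliWeight p) (ind {ω : Set (Fin n) | φ.eval ((cubeEquivSet n).symm ω) = true}))
          * ex (bernoulliWeight p) (ind (A ∩ B ∩ {ω : Set (Fin n) | φ.eval ((cubeEquivSet n).symm ω) = true}))
        - ex (bernoulliWeight p) (ind {ω : Set (Fin n) | φ.eval ((cubeEquivSet n).symm ω) = true}) * ex (bernoulliWeight p) (ind (A ∩ B))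
        - ex (bernoulliWeight p) (ind (A ∩ {ω : Set (Fin n) | φ.eval ((cubeEquivSet n).symm ω) = true}))
          * ex (bernoulliWeight p) (ind (B ∩ {ω : Set (Fin n) | φ.eval ((cubeEquivSet n).symm ω) = true})) :=
  fIneq_nonneg_fin_of_cube p A B _ (fun s => decide (cubeEquivSet n s ∈ A)) (fun s => decide (cubeEquivSet n s ∈ B))
    φ.eval (rep_decide A) (rep_decide B) (rep_eval φ)
    (SahiFComb.F_nonneg_of_eq_readOnce φ hφ (fun i => (p i : ℝ)) (fun i => (p i).2.1) (fun i => (p i).2.2)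
      (fun s => decide (cubeEquivSet n s ∈ A)) (fun s => decide (cubeEquivSet n s ∈ B)) φ.eval
      (monotone_of_rep hA (rep_decide A)) (monotone_of_rep hB (rep_decide B)) rfl)

end Cube

/-! ### 2. Any finite index type: relabelling along `ι ≃ Fin n` -/

section Transport

variable {ι κ : Type} [Fintype ι] [Fintype κ]

/-- Expectations of indicators transport along a relabelling (`E₁` case of `sahiE_bernoulliWeight_comap_equiv`). [this work] -/
theorem ex_ind_comapFam (e : ι ≃ κ) (p : ι → unitInterval) (X : Set (Set ι)) :
    ex (bernoulliWeight (p ∘ e.symm)) (ind (comapFam e.symm X)) = ex (bernoulliWeight p) (ind X) := by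
  have h := sahiE_bernoulliWeight_comap_equiv e p 1 (fun _ => X)
  rw [sahiE_one_apply, sahiE_one_apply] at h
  exact h

/-- **Transfer along a relabelling.**  `F(A,B;G)` at `(ι, p)` equals `F` of the pulled-back events at `(κ, p ∘ e⁻¹)`; so `F ≥ 0` transfers. [this work] -/
theorem fIneq_nonneg_of_equiv (e : ι ≃ κ) (p : ι → unitInterval) (A B G : Set (Set ι))
    (h : 0 ≤ (1 + ex (bernoulliWeight (p ∘ e.symm)) (ind (comapFam e.symm G)))
          * ex (bernoulliWeight (p ∘ e.symm)) (ind (comapFam e.symm A ∩ comapFam e.symm B ∩ comapFam e.symm G))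
        - ex (bernoulliWeight (p ∘ e.symm)) (ind (comapFam e.symm G))
          * ex (bernoulliWeight (p ∘ e.symm)) (ind (comapFam e.symm A ∩ comapFam e.symm B))
        - ex (bernoulliWeight (p ∘ e.symm)) (ind (comapFam e.symm A ∩ comapFam e.symm G))
          * ex (bernoulliWeight (p ∘ e.symm)) (ind (comapFam e.symm B ∩ comapFam e.symm G))) :
    0 ≤ (1 + ex (bernoulliWeight p) (ind G)) * ex (bernoulliWeight p) (ind (A ∩ B ∩ G))
        - ex (bernoulliWeight p) (ind G) * ex (bernoulliWeight p) (ind (A ∩ B))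
        - ex (bernoulliWeight p) (ind (A ∩ G)) * ex (bernoulliWeight p) (ind (B ∩ G)) := by
  simp only [← comapFam_inter, ex_ind_comapFam] at h
  exact h

omit [Fintype ι] [Fintype κ] in
/-- Pull-back of a threshold event is the threshold event. [this work] -/
theorem comapFam_threshold (e : ι ≃ κ) (t : ℕ) :
    comapFam e.symm {ω : Set ι | t ≤ ω.ncard} = {ω' : Set κ | t ≤ ω'.ncard} := by
  ext ω'
  simp only [comapFam, Set.mem_setOf_eq]
  rw [Set.ncard_image_of_injective _ e.symm.injective]

/-- **THEOREM (`F ≥ 0` for threshold third events, tree vocabulary).**  For every finite `ι`, every `p : ι → [0,1]`, all increasing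
`A, B ⊆ Set (Set ι)` and `G = {ω | t ≤ ω.ncard}` ("at least `t` coordinates open"; majority when `|ι| = 2t − 1`):
`(1 + μG)·μ(A∩B∩G) − μG·μ(A∩B) − μ(A∩G)·μ(B∩G) ≥ 0`, `μ = ex (bernoulliWeight p) (ind ·)`. [this work] -/
theorem fIneq_nonneg_of_threshold (p : ι → unitInterval) (A B : Set (Set ι)) (hA : IsUpperSet A) (hB : IsUpperSet B) (t : ℕ) :
    0 ≤ (1 + ex (bernoulliWeight p) (ind {ω : Set ι | t ≤ ω.ncard}))
          * ex (bernoulliWeight p) (ind (A ∩ B ∩ {ω : Set ι | t ≤ ω.ncard}))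
        - ex (bernoulliWeight p) (ind {ω : Set ι | t ≤ ω.ncard}) * ex (bernoulliWeight p) (ind (A ∩ B))
        - ex (bernoulliWeight p) (ind (A ∩ {ω : Set ι | t ≤ ω.ncard}))
          * ex (bernoulliWeight p) (ind (B ∩ {ω : Set ι | t ≤ ω.ncard})) := by
  obtain ⟨e⟩ : Nonempty (ι ≃ Fin (Fintype.card ι)) := ⟨Fintype.equivFin ι⟩
  refine fIneq_nonneg_of_equiv e p A B _ ?_
  rw [comapFam_threshold]
  exact fIneq_nonneg_fin_threshold _ t (p ∘ e.symm) _ _ (isUpperSet_comapFam e hA) (isUpperSet_comapFam e hB)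

omit [Fintype ι] in
/-- Pull-back of the event cut out by a formula read through the enumeration `e`. [this work] -/
theorem comapFam_eval {n : ℕ} (e : ι ≃ Fin n) (φ : SahiFComb.MForm n) :
    comapFam e.symm {ω : Set ι | φ.eval ((cubeEquivSet n).symm (e '' ω)) = true}
      = {ω' : Set (Fin n) | φ.eval ((cubeEquivSet n).symm ω') = true} := by
  ext ω'
  simp only [comapFam, Set.mem_setOf_eq, Equiv.image_symm_image]

/-- **THEOREM (`F ≥ 0` for read-once third events, tree vocabulary).**  For every finite `ι` enumerated by `e : ι ≃ Fin n`, every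
read-once monotone formula `φ` (AND/OR tree, each variable at most once), every `p : ι → [0,1]` and all increasing `A, B ⊆ Set (Set ι)`,
with `G = {ω | φ holds at the Boolean point of e(ω)}`:
`(1 + μG)·μ(A∩B∩G) − μG·μ(A∩B) − μ(A∩G)·μ(B∩G) ≥ 0`, `μ = ex (bernoulliWeight p) (ind ·)`. [this work] -/
theorem fIneq_nonneg_of_readOnce {n : ℕ} (e : ι ≃ Fin n) (φ : SahiFComb.MForm n) (hφ : φ.ReadOnce) (p : ι → unitInterval)
    (A B : Set (Set ι)) (hA : IsUpperSet A) (hB : IsUpperSet B) :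
    0 ≤ (1 + ex (bernoulliWeight p) (ind {ω : Set ι | φ.eval ((cubeEquivSet n).symm (e '' ω)) = true}))
          * ex (bernoulliWeight p) (ind (A ∩ B ∩ {ω : Set ι | φ.eval ((cubeEquivSet n).symm (e '' ω)) = true}))
        - ex (bernoulliWeight p) (ind {ω : Set ι | φ.eval ((cubeEquivSet n).symm (e '' ω)) = true}) * ex (bernoulliWeight p) (ind (A ∩ B))
        - ex (bernoulliWeight p) (ind (A ∩ {ω : Set ι | φ.eval ((cubeEquivSet n).symm (e '' ω)) = true}))
          * ex (bernoulliWeight p) (ind (B ∩ {ω : Set ι | φ.eval ((cubeEquivSet n).symm (e '' ω)) = true})) := by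
  refine fIneq_nonneg_of_equiv e p A B _ ?_
  rw [comapFam_eval]
  exact fIneq_nonneg_fin_readOnce φ hφ (p ∘ e.symm) _ _ (isUpperSet_comapFam e hA) (isUpperSet_comapFam e hB)

/-- Opaque-`G` form of `fIneq_nonneg_of_readOnce` (any `G` propositionally equal to a read-once event). [this work] -/
theorem fIneq_nonneg_of_eq_readOnce {n : ℕ} (e : ι ≃ Fin n) (φ : SahiFComb.MForm n) (hφ : φ.ReadOnce) (p : ι → unitInterval)
    (A B G : Set (Set ι)) (hA : IsUpperSet A) (hB : IsUpperSet B) (hG : G = {ω : Set ι | φ.eval ((cubeEquivSet n).symm (e '' ω)) = true}) :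
    0 ≤ (1 + ex (bernoulliWeight p) (ind G)) * ex (bernoulliWeight p) (ind (A ∩ B ∩ G))
        - ex (bernoulliWeight p) (ind G) * ex (bernoulliWeight p) (ind (A ∩ B))
        - ex (bernoulliWeight p) (ind (A ∩ G)) * ex (bernoulliWeight p) (ind (B ∩ G)) := by
  subst hG; exact fIneq_nonneg_of_readOnce e φ hφ p A B hA hB

/-- Opaque-`G` form of `fIneq_nonneg_of_threshold`. [this work] -/
theorem fIneq_nonneg_of_eq_threshold (p : ι → unitInterval) (A B G : Set (Set ι)) (hA : IsUpperSet A) (hB : IsUpperSet B) (t : ℕ)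
    (hG : G = {ω : Set ι | t ≤ ω.ncard}) :
    0 ≤ (1 + ex (bernoulliWeight p) (ind G)) * ex (bernoulliWeight p) (ind (A ∩ B ∩ G))
        - ex (bernoulliWeight p) (ind G) * ex (bernoulliWeight p) (ind (A ∩ B))
        - ex (bernoulliWeight p) (ind (A ∩ G)) * ex (bernoulliWeight p) (ind (B ∩ G)) := by
  subst hG; exact fIneq_nonneg_of_threshold p A B hA hB t

end Transport

/-! ### 3. The D0-core consequences (`Pointwise.sahiE_three_ge_sq_minor_of_F_nonneg` fires) -/

section Core

variable {ι : Type} [Fintype ι]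
variable (p : ι → unitInterval) (e : ι) (U : Fin 3 → Set (Set ι)) (hU : ∀ j, IsUpperSet (U j))
  (hG : secAt e true (U 2) = secAt e false (U 2))
  (hXG : secAt e false (U 0) ⊆ secAt e false (U 2)) (hYG : secAt e false (U 1) ⊆ secAt e false (U 2))
  (hXY : ex (bernoulliWeight p) (ind (secAt e false (U 0) ∩ secAt e false (U 1)))
    = ex (bernoulliWeight p) (ind (secAt e false (U 0))) * ex (bernoulliWeight p) (ind (secAt e false (U 1))))
include hU hG hXG hYG hXY

/-- **MD₃ on the D0 core when the third member is READ-ONCE.**  Under the hypotheses of `Pointwise.sahiE_three_ge_sq_minor_of_F_nonneg`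
(increasing triple `U`, `e`-free third member whose `0`-section contains both `0`-sections of `U_0, U_1`, these independent), if
`U_2^{e←0}` is cut out by a read-once monotone formula over an enumeration of `ι`, then `(1−p_e)²E₃(U⁰) + p_e²E₃(U¹) ≤ E₃(U)`. [this work] -/
theorem sahiE_three_ge_sq_minor_of_third_readOnce {n : ℕ} (en : ι ≃ Fin n) (φ : SahiFComb.MForm n) (hφ : φ.ReadOnce)
    (hGdef : secAt e false (U 2) = {ω : Set ι | φ.eval ((cubeEquivSet n).symm (en '' ω)) = true}) :
    (1 - (p e : ℝ)) ^ 2 * sahiE (bernoulliWeight p) 3 (fun j => ind (secAt e false (U j)))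
      + (p e : ℝ) ^ 2 * sahiE (bernoulliWeight p) 3 (fun j => ind (secAt e true (U j)))
      ≤ sahiE (bernoulliWeight p) 3 (fun j => ind (U j)) := by
  refine Pointwise.sahiE_three_ge_sq_minor_of_F_nonneg p e U hU hG hXG hYG hXY ?_
  exact fIneq_nonneg_of_eq_readOnce en φ hφ p _ _ _ (isUpperSet_secAt e true (hU 0)) (isUpperSet_secAt e true (hU 1)) hGdef

/-- **MD₃ on the D0 core when the third member is a THRESHOLD event** `{ω | t ≤ ω.ncard}` (as a set of configurations on `ι`; with the
`e`-freeness hypothesis `hG` this is the extreme case `t = 0`, recorded for the interface — the junta/face version is future work). [this work] -/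
theorem sahiE_three_ge_sq_minor_of_third_threshold (t : ℕ) (hGdef : secAt e false (U 2) = {ω : Set ι | t ≤ ω.ncard}) :
    (1 - (p e : ℝ)) ^ 2 * sahiE (bernoulliWeight p) 3 (fun j => ind (secAt e false (U j)))
      + (p e : ℝ) ^ 2 * sahiE (bernoulliWeight p) 3 (fun j => ind (secAt e true (U j)))
      ≤ sahiE (bernoulliWeight p) 3 (fun j => ind (U j)) := by
  refine Pointwise.sahiE_three_ge_sq_minor_of_F_nonneg p e U hU hG hXG hYG hXY ?_
  exact fIneq_nonneg_of_eq_threshold p _ _ _ (isUpperSet_secAt e true (hU 0)) (isUpperSet_secAt e true (hU 1)) t hGdef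

end Core

end SahiFCombBridge

end Summit.CriticalPhenomena.PercolationContinuityZ3.Theorems
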